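import Summits.Parity.GeneralizedHardyLittlewood.Theorems.FordMaynardNoSieveConst0164NegWitness0164J3Log

/-!
# Route `FordMaynardNoSieveConst0164`, crux `NegWitness0164` (stmt-Parity-19102), line `birth`,
# stub `stub_tweakNeg0164`: the kernel `K(α)` of (II) in closed form on the whole range `α ∈ [1/2, 1 − 2ν]`

Helper file toward the certificate stub (K. Ford, J. Maynard, *On the theory of prime producing sieves*,
arXiv:2407.14368, §8, `F₄(α) = log(α/max(ν, α−1/2) − 1)`).  `K3_closed_form_0164` (`…J3Log`) was stated for
`1/2 < w ≤ 1`; inequality (II) of `stub_tweakNeg0164_of_cellTable` needs `α = 1 − |b|` down to `α = 1/2` (`|b| = 1/2`).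
`K3_closed_form_0164'` covers `2ν < w ≤ 1`, and `rhs_II_closed_form_0164` writes the right-hand side of (II),
`1 + (α/2) K(α)`, in closed form for every admissible `b`.  Def-free.

References: [FordMaynard2024PrimeSieves] arXiv:2407.14368, §8 (F₄).
-/

noncomputable section

open Finset MeasureTheory Set
open scoped Classical
open Literature.NumberTheory.Sieve Literature.NumberTheory.Sieve.FordMaynard

namespace Summit.Parity.GeneralizedHardyLittlewood.FordMaynardNoSieveConst0164NegWitness0164

/-- **`K(w)` in closed form for `2ν < w ≤ 1`** (`ν = 41/250`): `(log((1/2)/(w−1/2)) − log((w−1/2)/(1/2)))/w` if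
`w ≥ 1/2 + ν`, else `(log((w−ν)/ν) − log(ν/(w−ν)))/w`. [cite: FordMaynard2024PrimeSieves, §8 (F₄(α))] -/
theorem K3_closed_form_0164' {w : ℝ} (hw1 : 2 * (41 / 250) < w) (hw2 : w ≤ 1) :
    sliceIntegral 2 w (fun v => if (∀ i, (41 / 250 : ℝ) ≤ v i) ∧ (∀ i, v i < 1 / 2) then 1 / (v 0 * v 1) else 0) =
      if 1 / 2 + 41 / 250 ≤ w then
        (Real.log ((1 / 2) / (w - 1 / 2)) - Real.log ((w - 1 / 2) / (w - (w - 1 / 2)))) / w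
      else (Real.log ((w - 41 / 250) / (w - (w - 41 / 250))) - Real.log ((41 / 250) / (w - 41 / 250))) / w := by
  split_ifs with h
  · exact K3_eq_log_upper_0164 h hw2
  · push Not at h
    rw [K3_eq_window_lower_0164 h.le, K3_eq_log_lower_0164 hw1]

/-- **The right-hand side of (II) in closed form**: for `b ∈ [ν, 1/2)²` with `|b| ≤ 1/2`, `α = 1 − |b|`,
`1 + (α/2)·K(α) = 1 + (1/2)·(log-difference)` as given by `K3_closed_form_0164'` (Ford–Maynard's `1 + F₄(α)`).
[cite: FordMaynard2024PrimeSieves, §8 ("f_{2,1}(β₁,β₂,α) = F₄(α) − F₅(β₁,β₂)")] -/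
theorem rhs_II_closed_form_0164 (b : Fin 2 → ℝ) (hb : ∀ i, (41 / 250 : ℝ) ≤ b i) (hbs : ∑ i, b i ≤ 1 / 2) :
    1 + (1 - ∑ i, b i) / 2 * sliceIntegral 2 (1 - ∑ i, b i) (fun v =>
        if (∀ i, (41 / 250 : ℝ) ≤ v i) ∧ (∀ i, v i < 1 / 2) then 1 / (v 0 * v 1) else 0) =
      1 + (1 - ∑ i, b i) / 2 * (if 1 / 2 + 41 / 250 ≤ 1 - ∑ i, b i then
        (Real.log ((1 / 2) / (1 - ∑ i, b i - 1 / 2)) -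
          Real.log ((1 - ∑ i, b i - 1 / 2) / (1 - ∑ i, b i - (1 - ∑ i, b i - 1 / 2)))) / (1 - ∑ i, b i)
      else (Real.log ((1 - ∑ i, b i - 41 / 250) / (1 - ∑ i, b i - (1 - ∑ i, b i - 41 / 250))) -
          Real.log ((41 / 250) / (1 - ∑ i, b i - 41 / 250))) / (1 - ∑ i, b i)) := by
  have hb0 := hb 0; have hb1 := hb 1
  rw [Fin.sum_univ_two] at hbs ⊢
  rw [K3_closed_form_0164' (by linarith) (by linarith)]

end Summit.Parity.GeneralizedHardyLittlewood.FordMaynardNoSieveConst0164NegWitness0164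

end
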